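import Mathlib
import Summits.Ventures.PercRepro2.Defs
import Summits.Ventures.PercRepro2.Harris
import Summits.Ventures.PercRepro2.CoinDefs
import Summits.Ventures.PercRepro2.CoinInduced
import Summits.Ventures.PercRepro2.CoinLsmCoreDefs
import Summits.Ventures.PercRepro2.CoinLsmCoreU
import Summits.Ventures.PercRepro2.CoinOrTailKDefs
import Summits.Ventures.PercRepro2.CoinOrTailKSums
import Summits.Ventures.PercRepro2.CoinKSureCoinsAlg
import Summits.Ventures.PercRepro2.CoinSubdivide
import Summits.Ventures.PercRepro2.CoinKSureSubOrTail
import Summits.Ventures.PercRepro2.CoinKSureSubLsm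

/-!
# Subdivision of ANY set of single-arc coins leaving a closed-in core (blind cell PercRepro2,
night-2 g15; proofs/NIGHT2-DARC.md §54)

`CoinKSureSubOrTail` / `CoinKSureSubLsm` subdivide the entry coins of ONE OR-tail.  Here the set
`S` of subdivided coins is arbitrary: single arcs `src e → tgt e` with `src e ∈ U` and
`tgt e ∉ U ∪ {s}`.  Every new vertex is again a one-entry OR-tail of the partial extended core
(`orTailK_sub_step_gen`), the level law factorises one coin at a time (`subLawS_insert`) and
the extended core `subCore U S` is log-supermodular whenever `U` is (`subCore_lsm_gen`).
An OR-tail whose coins are NOT subdivided and whose tail is not a subdivided target survives the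
subdivision, over the extended core (`orTailK_sub_untouched`).
-/

namespace Summit.Ventures.PercRepro2.Coin

open Classical

section SubStepGen

variable {V : Type*} {E : Type*} [DecidableEq V] [DecidableEq E]
  {arcs : E → Finset (V × V)} {s : V} {U : Finset V} {S : Finset E} {src tgt : E → V}

/-- **One step of the extension for a general coin set**: the new vertex `inr e` of a subdivided
coin `e ∉ S₀` is a one-entry OR-tail of the extended core `subCore U S₀`. -/
theorem orTailK_sub_step_gen (hU : ClosedInCoreU arcs s U) (hsrc : ∀ e ∈ S, src e ∈ U)
    (htgt : ∀ e ∈ S, tgt e ∉ U) (htgts : ∀ e ∈ S, tgt e ≠ s)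
    {S₀ : Finset E} {e : E} (he : e ∈ S) (heS₀ : e ∉ S₀) :
    OrTailK (subArcs arcs S src tgt) (Sum.inl s) (subCore U S₀) {Sum.inl (src e)}
      (fun _ => Sum.inl e) (Sum.inr e) where
  ent_sub := by
    intro x hx
    rw [Finset.mem_singleton] at hx
    rw [hx, inl_mem_subCore]
    exact hsrc e he
  s_notin := by rw [inl_mem_subCore]; exact hU.s_notin
  a_notin := by rw [inr_mem_subCore]; exact heS₀
  a_ne_s := Sum.inr_ne_inl
  into_U := by
    intro e' xy hxy hy
    cases e' with
    | inl e₁ =>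
      simp only [subArcs] at hxy
      by_cases h₁ : e₁ ∈ S
      · rw [if_pos h₁, Finset.mem_singleton] at hxy
        rw [hxy]
        exact Or.inl ((inl_mem_subCore).2 (hsrc e₁ h₁))
      · rw [if_neg h₁] at hxy
        obtain ⟨⟨x, y⟩, hxy₀, hf⟩ := Finset.mem_map.1 hxy
        have hf' : (Sum.inl x, Sum.inl y) = xy := hf
        rw [← hf'] at hy ⊢
        have hyU : y ∈ U := (inl_mem_subCore).1 hy
        rcases hU.into_C e₁ (x, y) hxy₀ hyU with hx | hx
        · exact Or.inl ((inl_mem_subCore).2 hx)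
        · exact Or.inr (by rw [show x = s from hx])
    | inr e₁ =>
      simp only [subArcs] at hxy
      by_cases h₁ : e₁ ∈ S
      · rw [if_pos h₁, Finset.mem_singleton] at hxy
        rw [hxy] at hy
        exact absurd ((inl_mem_subCore).1 hy) (htgt e₁ h₁)
      · rw [if_neg h₁] at hxy
        exact absurd hxy (Finset.notMem_empty _)
  into_s := by
    intro e' xy hxy hy
    cases e' with
    | inl e₁ =>
      simp only [subArcs] at hxy
      by_cases h₁ : e₁ ∈ S
      · rw [if_pos h₁, Finset.mem_singleton] at hxy
        rw [hxy] at hy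
        exact absurd hy Sum.inr_ne_inl
      · rw [if_neg h₁] at hxy
        obtain ⟨⟨x, y⟩, hxy₀, hf⟩ := Finset.mem_map.1 hxy
        have hf' : (Sum.inl x, Sum.inl y) = xy := hf
        rw [← hf'] at hy ⊢
        have hys : y = s := Sum.inl_injective hy
        rcases hU.into_s e₁ (x, y) hxy₀ hys with hx | hx
        · exact Or.inl ((inl_mem_subCore).2 hx)
        · exact Or.inr (by rw [show x = s from hx])
    | inr e₁ =>
      simp only [subArcs] at hxy
      by_cases h₁ : e₁ ∈ S
      · rw [if_pos h₁, Finset.mem_singleton] at hxy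
        rw [hxy] at hy
        exact absurd (Sum.inl_injective hy) (htgts e₁ h₁)
      · rw [if_neg h₁] at hxy
        exact absurd hxy (Finset.notMem_empty _)
  into_a := by
    intro e' xy hxy hy
    cases e' with
    | inl e₁ =>
      simp only [subArcs] at hxy
      by_cases h₁ : e₁ ∈ S
      · rw [if_pos h₁, Finset.mem_singleton] at hxy
        rw [hxy] at hy ⊢
        have : e₁ = e := Sum.inr_injective hy
        subst this
        exact ⟨Sum.inl (src e₁), Finset.mem_singleton_self _, rfl, rfl⟩
      · rw [if_neg h₁] at hxy
        obtain ⟨⟨x, y⟩, _, hf⟩ := Finset.mem_map.1 hxy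
        have hf' : (Sum.inl x, Sum.inl y) = xy := hf
        rw [← hf'] at hy
        exact absurd hy Sum.inl_ne_inr
    | inr e₁ =>
      simp only [subArcs] at hxy
      by_cases h₁ : e₁ ∈ S
      · rw [if_pos h₁, Finset.mem_singleton] at hxy
        rw [hxy] at hy
        exact absurd hy Sum.inl_ne_inr
      · rw [if_neg h₁] at hxy
        exact absurd hxy (Finset.notMem_empty _)
  arcs_c := by
    intro r hr
    rw [Finset.mem_singleton] at hr
    rw [hr]
    simp only [subArcs, if_pos he]
  c_inj := by
    intro r hr r' hr' _
    rw [Finset.mem_singleton] at hr hr'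
    rw [hr, hr']

end SubStepGen

section SubLsmGen

variable {V : Type*} {E : Type*} [DecidableEq V] [Fintype E] [DecidableEq E]
  {R : Type*} [Field R] [LinearOrder R] [IsStrictOrderedRing R]
  {arcs : E → Finset (V × V)} {s : V} {U : Finset V} {S : Finset E} {src tgt : E → V}

/-- The cluster law of the extended core `subCore U S₀` for a general subdivided coin set. -/
noncomputable def subLawS (pr : E → R) (arcs : E → Finset (V × V)) (S : Finset E) (src tgt : E → V)
    (s : V) (U : Finset V) (S₀ : Finset E) (W : Finset (V ⊕ E)) : R :=
  prob (subPr pr) (coreLevel (subArcs arcs S src tgt) (Sum.inl s) (subCore U S₀) W)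

omit [LinearOrder R] [IsStrictOrderedRing R] in
/-- **One step of the factorisation** for a general subdivided coin set. -/
lemma subLawS_insert (pr : E → R) (hU : ClosedInCoreU arcs s U) (hsrc : ∀ e ∈ S, src e ∈ U)
    (htgt : ∀ e ∈ S, tgt e ∉ U) (htgts : ∀ e ∈ S, tgt e ≠ s)
    {S₀ : Finset E} {e : E} (he : e ∈ S) (heS₀ : e ∉ S₀) (W : Finset (V ⊕ E)) :
    subLawS pr arcs S src tgt s U (insert e S₀) W =
      subLawS pr arcs S src tgt s U S₀ (W ∩ subCore U S₀) *
        (if Sum.inr e ∈ W then (if Sum.inl (src e) ∈ W then pr e else 0)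
          else (if Sum.inl (src e) ∈ W then 1 - pr e else 1)) := by
  have hstep := orTailK_sub_step_gen hU hsrc htgt htgts (S₀ := S₀) he heS₀
  unfold subLawS
  rw [subCore_insert, hstep.prob_coreLevel_eq (subPr pr) W, hstep.prob_tailEventK (subPr pr) W]
  have htw : tailWtK (subPr pr) {Sum.inl (src e)} (fun _ => Sum.inl e) W =
      1 - pr e * (if Sum.inl (src e) ∈ W then 1 else 0) := by
    unfold tailWtK
    rw [Finset.prod_singleton]
    rfl
  rw [htw]
  split_ifs <;> ring

/-- **The extended core is log-supermodular** for a general subdivided coin set. -/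
theorem subCore_lsm_gen (pr : E → R) (hp : IsProbVec pr) (hU : ClosedInCoreU arcs s U)
    (hS : ∀ e ∈ S, arcs e = {(src e, tgt e)}) (hsrc : ∀ e ∈ S, src e ∈ U)
    (htgt : ∀ e ∈ S, tgt e ∉ U) (htgts : ∀ e ∈ S, tgt e ≠ s)
    (hν : ∀ W W', W ⊆ U → W' ⊆ U →
      prob pr (coreLevel arcs s U W) * prob pr (coreLevel arcs s U W') ≤
        prob pr (coreLevel arcs s U (W ∩ W')) * prob pr (coreLevel arcs s U (W ∪ W')))
    (S₀ : Finset E) :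
    S₀ ⊆ S → ∀ W₁ ⊆ subCore U S₀, ∀ W₂ ⊆ subCore U S₀,
      subLawS pr arcs S src tgt s U S₀ W₁ * subLawS pr arcs S src tgt s U S₀ W₂ ≤
        subLawS pr arcs S src tgt s U S₀ (W₁ ∩ W₂) *
          subLawS pr arcs S src tgt s U S₀ (W₁ ∪ W₂) := by
  induction S₀ using Finset.induction_on with
  | empty =>
    intro _ W₁ hW₁ W₂ hW₂
    have hc : subCore U (∅ : Finset E) = U.map Function.Embedding.inl := by
      simp [subCore]
    rw [hc] at hW₁ hW₂
    obtain ⟨W₁₀, hW₁₀, rfl⟩ := Finset.subset_map_iff.1 hW₁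
    obtain ⟨W₂₀, hW₂₀, rfl⟩ := Finset.subset_map_iff.1 hW₂
    simp only [subLawS, hc]
    rw [← Finset.map_inter, ← Finset.map_union, prob_sub, prob_sub, prob_sub, prob_sub,
      coreLevel_sub_preimage hS, coreLevel_sub_preimage hS, coreLevel_sub_preimage hS,
      coreLevel_sub_preimage hS]
    exact hν W₁₀ W₂₀ hW₁₀ hW₂₀
  | insert e S₀ heS₀ ih =>
    intro hsub W₁ hW₁ W₂ hW₂
    have hS₀ : S₀ ⊆ S := (Finset.subset_insert e S₀).trans hsub
    have he : e ∈ S := hsub (Finset.mem_insert_self e S₀)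
    rw [subCore_insert] at hW₁ hW₂
    have key := extLaw_lsm (subCore U S₀) (subLawS pr arcs S src tgt s U S₀)
      (Sum.inl (src e)) (Sum.inr e) (pr e) (hp.nonneg e) (hp.le_one e)
      (fun W => prob_nonneg (isProbVec_subPr hp) _) (ih hS₀) W₁ hW₁ W₂ hW₂
    rw [subLawS_insert pr hU hsrc htgt htgts he heS₀ W₁,
      subLawS_insert pr hU hsrc htgt htgts he heS₀ W₂,
      subLawS_insert pr hU hsrc htgt htgts he heS₀ (W₁ ∩ W₂),
      subLawS_insert pr hU hsrc htgt htgts he heS₀ (W₁ ∪ W₂)]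
    exact key

end SubLsmGen

section SubUntouched

variable {V : Type*} {E : Type*} [DecidableEq V] [DecidableEq E]
  {arcs : E → Finset (V × V)} {s : V} {S : Finset E} {src tgt : E → V}

/-- **An OR-tail survives the subdivision of other coins**: if none of its entry coins is
subdivided and its tail is not a subdivided target, it is an OR-tail of the subdivided system
over the extended core (the old entries, relabelled). -/
theorem orTailK_sub_untouched {U₀ ent₀ : Finset V} {c₀ : V → E} {a₀ : V}
    (h₀ : OrTailK arcs s U₀ ent₀ c₀ a₀) (hsrc : ∀ e ∈ S, src e ∈ U₀)
    (htgt : ∀ e ∈ S, tgt e ∉ U₀) (htgts : ∀ e ∈ S, tgt e ≠ s) (htgta : ∀ e ∈ S, tgt e ≠ a₀)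
    (hc₀ : ∀ r ∈ ent₀, c₀ r ∉ S) :
    OrTailK (subArcs arcs S src tgt) (Sum.inl s) (subCore U₀ S) (ent₀.map Function.Embedding.inl)
      (Sum.elim (fun v => Sum.inl (c₀ v)) (fun e => Sum.inr e)) (Sum.inl a₀) where
  ent_sub := by
    intro x hx
    obtain ⟨r, hr, rfl⟩ := Finset.mem_map.1 hx
    exact (inl_mem_subCore).2 (h₀.ent_sub hr)
  s_notin := by rw [inl_mem_subCore]; exact h₀.s_notin
  a_notin := by rw [inl_mem_subCore]; exact h₀.a_notin
  a_ne_s := fun e => h₀.a_ne_s (Sum.inl_injective e)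
  into_U := by
    intro e' xy hxy hy
    cases e' with
    | inl e₁ =>
      simp only [subArcs] at hxy
      by_cases h₁ : e₁ ∈ S
      · rw [if_pos h₁, Finset.mem_singleton] at hxy
        rw [hxy]
        exact Or.inl ((inl_mem_subCore).2 (hsrc e₁ h₁))
      · rw [if_neg h₁] at hxy
        obtain ⟨⟨x, y⟩, hxy₀, hf⟩ := Finset.mem_map.1 hxy
        have hf' : (Sum.inl x, Sum.inl y) = xy := hf
        rw [← hf'] at hy ⊢
        have hyU : y ∈ U₀ := (inl_mem_subCore).1 hy
        rcases h₀.into_U e₁ (x, y) hxy₀ hyU with hx | hx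
        · exact Or.inl ((inl_mem_subCore).2 hx)
        · exact Or.inr (by rw [show x = s from hx])
    | inr e₁ =>
      simp only [subArcs] at hxy
      by_cases h₁ : e₁ ∈ S
      · rw [if_pos h₁, Finset.mem_singleton] at hxy
        rw [hxy] at hy
        exact absurd ((inl_mem_subCore).1 hy) (htgt e₁ h₁)
      · rw [if_neg h₁] at hxy
        exact absurd hxy (Finset.notMem_empty _)
  into_s := by
    intro e' xy hxy hy
    cases e' with
    | inl e₁ =>
      simp only [subArcs] at hxy
      by_cases h₁ : e₁ ∈ S
      · rw [if_pos h₁, Finset.mem_singleton] at hxy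
        rw [hxy] at hy
        exact absurd hy Sum.inr_ne_inl
      · rw [if_neg h₁] at hxy
        obtain ⟨⟨x, y⟩, hxy₀, hf⟩ := Finset.mem_map.1 hxy
        have hf' : (Sum.inl x, Sum.inl y) = xy := hf
        rw [← hf'] at hy ⊢
        have hys : y = s := Sum.inl_injective hy
        rcases h₀.into_s e₁ (x, y) hxy₀ hys with hx | hx
        · exact Or.inl ((inl_mem_subCore).2 hx)
        · exact Or.inr (by rw [show x = s from hx])
    | inr e₁ =>
      simp only [subArcs] at hxy
      by_cases h₁ : e₁ ∈ S
      · rw [if_pos h₁, Finset.mem_singleton] at hxy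
        rw [hxy] at hy
        exact absurd (Sum.inl_injective hy) (htgts e₁ h₁)
      · rw [if_neg h₁] at hxy
        exact absurd hxy (Finset.notMem_empty _)
  into_a := by
    intro e' xy hxy hy
    cases e' with
    | inl e₁ =>
      simp only [subArcs] at hxy
      by_cases h₁ : e₁ ∈ S
      · rw [if_pos h₁, Finset.mem_singleton] at hxy
        rw [hxy] at hy
        exact absurd hy Sum.inr_ne_inl
      · rw [if_neg h₁] at hxy
        obtain ⟨⟨x, y⟩, hxy₀, hf⟩ := Finset.mem_map.1 hxy
        have hf' : (Sum.inl x, Sum.inl y) = xy := hf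
        rw [← hf'] at hy ⊢
        have hya : y = a₀ := Sum.inl_injective hy
        obtain ⟨r, hr, he₁, hx⟩ := h₀.into_a e₁ (x, y) hxy₀ hya
        refine ⟨Sum.inl r, Finset.mem_map_of_mem _ hr, ?_, ?_⟩
        · change Sum.inl e₁ = Sum.inl (c₀ r)
          rw [he₁]
        · rw [show x = r from hx]
    | inr e₁ =>
      simp only [subArcs] at hxy
      by_cases h₁ : e₁ ∈ S
      · rw [if_pos h₁, Finset.mem_singleton] at hxy
        rw [hxy] at hy
        exact absurd (Sum.inl_injective hy) (htgta e₁ h₁)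
      · rw [if_neg h₁] at hxy
        exact absurd hxy (Finset.notMem_empty _)
  arcs_c := by
    intro r' hr'
    obtain ⟨r, hr, rfl⟩ := Finset.mem_map.1 hr'
    change subArcs arcs S src tgt (Sum.inl (c₀ r)) = {(Sum.inl r, Sum.inl a₀)}
    simp only [subArcs, if_neg (hc₀ r hr)]
    rw [h₀.arcs_c r hr, Finset.map_singleton]
    rfl
  c_inj := by
    intro r' hr' r'' hr'' heq
    obtain ⟨r, hr, rfl⟩ := Finset.mem_map.1 hr'
    obtain ⟨r₂, hr₂, rfl⟩ := Finset.mem_map.1 hr''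
    change (Sum.inl (c₀ r) : E ⊕ E) = Sum.inl (c₀ r₂) at heq
    change (Sum.inl r : V ⊕ E) = Sum.inl r₂
    rw [h₀.c_inj r hr r₂ hr₂ (Sum.inl_injective heq)]

end SubUntouched

end Summit.Ventures.PercRepro2.Coin
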